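import Literature.NumberTheory.ConnesConsani2021.ProlateIdentification
import HarnessLib

/-!
# An even eigenvector of the sinc operator whose entire witness solves the prolate equation lies in
# `span {ξ_n}` (the Re/Im step of module (b) of `CC2021_sec4_xi_complete`)

LINE 1 — FRAMING: RH-FREE classical analysis (Slepian–Pollak 1961 §III, the "lucky accident": joint
eigenvectors of the sinc operator `K = 𝒫₁𝒫̂₁𝒫₁` and of the prolate differential operator
`𝐖 = −d/dx (1−x²) d/dx + (2πx)²` are prolate spheroidal wave functions); cell rh-crit, corpus C1, seat gm-t14
(lead R66 (3)), row O10 module (b) (t3 `[𝐖, K] = 0`, t2 joint eigenbasis, gm-t14 THIS step, t3 assembly);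
bears_on: W-C/W-P (apex (A), K1 binder `CC2021_sec4_xi_complete`).  WHAT THIS IS NOT: any claim about RH —
nothing here bears on the truth of RH.

Topic `NumberTheory/ConnesConsani2021`; namespace `Literature.NumberTheory.ConnesConsani2021`.  Theorems
only: no definition, no named fact, no instance, no `sorry`.

Given an even eigenvector `S` of the sinc operator on `L²([−1,1])` with eigenvalue `ν ≠ 0`, seat t10's
`exists_entire_even_repr_of_sincOp_eq_smul` (`ProlateSincOperator`) provides ONE entire witness `G`
(`S = G|_ℝ` a.e. on `[−1,1]`, `G|_ℝ` even and smooth, pointwise eigen-equation on `[−1,1]`).  This file proves: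

* `prolateODE_clm_comp_of_complex`, `prolateODE_re_im_of_complex` — if a `C²` map `f : ℝ → ℂ` solves
  `−((1−x²)f′)′ + (2πx)² f = χ f` on `(−1,1)` with REAL `χ`, then so do `Re f` and `Im f` (and every
  real-linear image of `f`), in the exact spelling consumed by t10's
  `exists_eq_mul_prolateFun_of_even_ode_solution` / `mem_span_prolateXiI_of_entire_witness`
  (`ProlateIdentification`); `prolateOp_one_re_im_of_complex` — the same in the `prolateOp 1` spelling
  (the cell's `ReImProlateODEShape`, t10 2026-08-26);
* **`mem_span_prolateXiI_of_entire_of_prolateODE`** — if the entire witness `G` of an `L²([−1,1])` class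
  `S` (even, eigen-equation for some real `ν`) satisfies the prolate equation on `(−1,1)` for some REAL `χ`
  (the joint-eigenvector property delivered by `[𝐖, K] = 0` + the symmetric diagonalisation on the
  finite-dimensional eigenspace — seats t3/t2), then `S ∈ span {prolateXiI n}`: the one-call composition
  of `prolateODE_re_im_of_complex` with t10's `mem_span_prolateXiI_of_entire_witness`
  (`ProlateIdentification`), which does the zero counting, identification and recombination.

## References

* D. Slepian, H. O. Pollak, *Prolate spheroidal wave functions, Fourier analysis and uncertainty — I*,
  Bell System Tech. J. 40 (1961) 43–63, §III (commuting differential operator; eigenfunctions = PSWFs).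
  [SlepianPollak1961]
* A. Connes, C. Consani, *Weil positivity and trace formula, the archimedean place*, Selecta Math. 27
  (2021), §4 p. 16 (prolateeq)–(cosalphan1), Prop. 4.5 (i) (arXiv:2006.13771 p0016:L13–L52). [ConnesConsani2021]
-/

noncomputable section

open MeasureTheory Complex Set Filter
open scoped Real Topology

namespace Literature.NumberTheory.ConnesConsani2021

/-! ## Real-linear images of complex solutions of the prolate equation -/

/-- Derivative of a real-linear functional of a differentiable `ℝ → ℂ` map. [folklore] -/
private theorem deriv_clm_comp (φ : ℂ →L[ℝ] ℝ) {f : ℝ → ℂ} (hf : Differentiable ℝ f) (x : ℝ) :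
    deriv (fun y => φ (f y)) x = φ (deriv f x) :=
  (φ.hasFDerivAt.comp_hasDerivAt x (hf x).hasDerivAt).deriv

/-- **Real-linear images of a complex solution of the prolate equation solve it**: if `f ∈ C²(ℝ, ℂ)`
satisfies `−((1−x²)f′)′ + (2πx)²f = χ f` on `(−1,1)` with `χ ∈ ℝ`, then so does `φ ∘ f` for every
real-linear `φ : ℂ → ℝ`. [cite: SlepianPollak1961, §III; ConnesConsani2021, §4 p. 16 eq. (prolateeq) (arXiv p0016:L13–L34)] -/
theorem prolateODE_clm_comp_of_complex (φ : ℂ →L[ℝ] ℝ) {f : ℝ → ℂ} (hf : ContDiff ℝ 2 f) {χ : ℝ}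
    (hode : ∀ x ∈ Ioo (-1 : ℝ) 1,
      -(deriv (fun y : ℝ => ((1 ^ 2 - y ^ 2 : ℝ) : ℂ) * deriv f y) x) + (((2 * π * 1 * x) ^ 2 : ℝ) : ℂ) * f x =
        (χ : ℂ) * f x) :
    ∀ x ∈ Ioo (-1 : ℝ) 1,
      -(deriv (fun y ↦ (1 ^ 2 - y ^ 2) * deriv (fun t => φ (f t)) y) x) + (2 * π * 1 * x) ^ 2 * φ (f x) =
        χ * φ (f x) := by
  have hd : Differentiable ℝ f := hf.differentiable (by norm_num)
  have hf1 : ContDiff ℝ 1 (deriv f) := by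
    have h := (contDiff_succ_iff_deriv (n := 1) (f := f)).1 (by simpa [one_add_one_eq_two] using hf)
    exact h.2.2
  have hd' : Differentiable ℝ (deriv f) := hf1.differentiable one_ne_zero
  have hg : Differentiable ℝ (fun y : ℝ => ((1 ^ 2 - y ^ 2 : ℝ) : ℂ) * deriv f y) := by
    refine Differentiable.mul ?_ hd'
    exact Complex.ofRealCLM.differentiable.comp ((differentiable_const _).sub (differentiable_pow 2))
  intro x hx
  have h1 : (fun y ↦ (1 ^ 2 - y ^ 2) * deriv (fun t => φ (f t)) y) =
      fun y => φ (((1 ^ 2 - y ^ 2 : ℝ) : ℂ) * deriv f y) := by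
    funext y
    rw [deriv_clm_comp φ hd, ← smul_eq_mul, ← Complex.real_smul, φ.map_smul, smul_eq_mul]
  rw [h1, deriv_clm_comp φ hg x]
  have h2 := congrArg φ (hode x hx)
  rw [map_add, map_neg, ← Complex.real_smul, φ.map_smul, ← Complex.real_smul, φ.map_smul, smul_eq_mul,
    smul_eq_mul] at h2
  exact h2

/-- **The real and imaginary parts of a complex `C²` solution of the prolate equation (real `χ`) are
real solutions**, in the spelling of `exists_eq_mul_prolateFun_of_even_ode_solution`.
[cite: SlepianPollak1961, §III; ConnesConsani2021, §4 p. 16 eq. (prolateeq) (arXiv p0016:L13–L34)] -/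
theorem prolateODE_re_im_of_complex {f : ℝ → ℂ} (hf : ContDiff ℝ 2 f) {χ : ℝ}
    (hode : ∀ x ∈ Ioo (-1 : ℝ) 1,
      -(deriv (fun y : ℝ => ((1 ^ 2 - y ^ 2 : ℝ) : ℂ) * deriv f y) x) + (((2 * π * 1 * x) ^ 2 : ℝ) : ℂ) * f x =
        (χ : ℂ) * f x) :
    (∀ x ∈ Ioo (-1 : ℝ) 1,
      -(deriv (fun y ↦ (1 ^ 2 - y ^ 2) * deriv (fun t => (f t).re) y) x) + (2 * π * 1 * x) ^ 2 * (f x).re =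
        χ * (f x).re) ∧
    (∀ x ∈ Ioo (-1 : ℝ) 1,
      -(deriv (fun y ↦ (1 ^ 2 - y ^ 2) * deriv (fun t => (f t).im) y) x) + (2 * π * 1 * x) ^ 2 * (f x).im =
        χ * (f x).im) :=
  ⟨prolateODE_clm_comp_of_complex Complex.reCLM hf hode, prolateODE_clm_comp_of_complex Complex.imCLM hf hode⟩

/-- The same in the `prolateOp 1` spelling of `ProlateProjections` (t10's `ReImProlateODEShape`
verbatim). [cite: SlepianPollak1961, §III; ConnesConsani2021, §4 p. 16 eq. (prolateeq) (arXiv p0016:L13–L34)] -/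
theorem prolateOp_one_re_im_of_complex (g : ℝ → ℂ) (hg : ContDiff ℝ 2 g) (χ : ℝ)
    (hW : ∀ x ∈ Ioo (-1 : ℝ) 1,
      -(deriv (fun y : ℝ => (((1 : ℝ) ^ 2 - y ^ 2 : ℝ) : ℂ) * deriv g y) x) +
        (((2 * π * 1 * x) ^ 2 : ℝ) : ℂ) * g x = (χ : ℂ) * g x) :
    (∀ x ∈ Ioo (-1 : ℝ) 1, prolateOp 1 (fun t => (g t).re) x = χ * (g x).re) ∧
    (∀ x ∈ Ioo (-1 : ℝ) 1, prolateOp 1 (fun t => (g t).im) x = χ * (g x).im) :=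
  prolateODE_re_im_of_complex hg hW

/-! ## From the entire witness to `span {ξ_n}` -/

/-- An entire function restricts to a real-`C^n` function on the real line. [folklore] -/
private theorem contDiff_ofReal_comp_of_differentiable {G : ℂ → ℂ} (hGd : Differentiable ℂ G) (n : ℕ) :
    ContDiff ℝ n (fun x : ℝ => G x) :=
  ((hGd.contDiff (n := n)).restrict_scalars ℝ).comp Complex.ofRealCLM.contDiff

/-- **The Re/Im step of the completeness proof.**  Let `S ∈ L²([−1,1])` have an entire witness `G`
(`S = G|_ℝ` a.e. on `[−1,1]`, `G|_ℝ` even) satisfying the eigen-equation `ν G(y) = ∫_{−1}^{1} κ(y−x)G(x)dx`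
on `[−1,1]` for a real `ν` (exactly what `exists_entire_even_repr_of_sincOp_eq_smul` provides for an even
eigenvector of the sinc operator).  If `G|_ℝ` moreover solves the prolate equation
`−((1−x²)G′)′ + (2πx)²G = χG` on `(−1,1)` for a REAL `χ` (the joint-eigenvector property), then
`S ∈ span_ℂ {ξ_n}`. [cite: SlepianPollak1961, §III; ConnesConsani2021, Prop. 4.5 (i) §4 p. 16 (arXiv p0016:L48–L52)] -/
theorem mem_span_prolateXiI_of_entire_of_prolateODE
    {S : Lp ℂ 2 (volume.restrict (Icc (-1 : ℝ) 1))} {G : ℂ → ℂ} (hGd : Differentiable ℂ G)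
    (hGeven : ∀ y : ℝ, G (-y) = G y)
    (hSG : (S : ℝ → ℂ) =ᵐ[volume.restrict (Icc (-1 : ℝ) 1)] fun x : ℝ => G x) {ν : ℝ}
    (heq : ∀ y ∈ Icc (-1 : ℝ) 1, (ν : ℂ) * G y = ∫ x in Icc (-1 : ℝ) 1, sincKernel (y - x) * G x)
    (hW : ∃ χ : ℝ, ∀ x ∈ Ioo (-1 : ℝ) 1,
      -(deriv (fun y : ℝ => ((1 ^ 2 - y ^ 2 : ℝ) : ℂ) * deriv (fun t : ℝ => G t) y) x) +
          (((2 * π * 1 * x) ^ 2 : ℝ) : ℂ) * G x = (χ : ℂ) * G x) :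
    S ∈ Submodule.span ℂ (Set.range prolateXiI) := by
  obtain ⟨χ, hχ⟩ := hW
  obtain ⟨hre, him⟩ := prolateODE_re_im_of_complex (contDiff_ofReal_comp_of_differentiable hGd 2) hχ
  exact mem_span_prolateXiI_of_entire_witness hGd hGeven hSG heq ⟨χ, hre⟩ ⟨χ, him⟩

end Literature.NumberTheory.ConnesConsani2021
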